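import Summits.BirchSwinnertonDyer.BirchSwinnertonDyer.Theorems.SignedLowerHalvesSmallImageLowerHalfBothSignsLambdaLowerThreeNsThetaTransport
import HarnessLib

/-!
# Route `SignedLowerHalves`, crux L `SmallImageLowerHalfBothSigns` (item stmt-BirchSwinnertonDyer-23599), line
# `birth_acns` v15, stub `stub_lambdaLowerThree_ns`: the `p = 3` λ-stub is the `p = 3` TWIN of route
# `ResidualThetaTransportAtTwo` — part 3: the LEVEL-MATCHED residual-theta-transport statements (carry clause
# (C-S6/S7) of ARM-P sheet U-r02-AP typed), the λ-transport from them, `∃ ε, KobayashiMainConjecture` at every odd `p`,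
# and CLASS-WIDE at `p = 3` the registered stub VERBATIM (cell `bsd-ssimc`, width seat `bsd-line-slh-p3-w3` gen 8;
# helper, `--supports … --as helper`; THEOREMS ONLY — no definition, no named fact, no `sorry`; closes nothing;
# BSD is not proved by any of this)

HONEST FRAMING. Part 2 (`…ThetaTransport.lean`) typed K0@p / Kan@p / Kλ@p as the VERBATIM `p`-twins of route
`ResidualThetaTransportAtTwo`'s items K0⁺ / Kan⁺ / Kλ⁺. The ARM-P reader sheet U-r02-AP
(`pub/bsd-cited/sheets/D-AUDIT-r02-UAP-K3Seams-S2-S6-S7-S4-RTT3-CMThetaPartner-BYREF.md`, sha16 8e4a96cdaccc9405; words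
S2 / S6 / S7 = PRINT-COMPOSITE · junction ROUTINE, S4 = PRINT, 0 GAP) asks the port to CARRY a partner-LEVEL clause
(C-S6/S7) so that Vatsal's Condition 1 for the `S₀`-depleted pair is automatic (§4 (a) of the sheet: Condition 1 for
both depleted forms at the common level ⟺ `max(2, v_ℓ(N_W)) = max(2, v_ℓ(M))` at the depletion primes; only `ℓ = 2`
(and, at `p ≥ 5`, `ℓ = 3`) can fail it). This part re-types the three statements LEVEL-MATCHED:

* **K0₂@p** = K0@p ∧ `∀ ℓ prime, ℓ ≠ p → max 2 (v_ℓ M) = max 2 (v_ℓ N_W)` (the sheet's recommended equality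
  «`v₂(M) = v₂(N_W)`» is NOT used: it is unsatisfiable when `W` is multiplicative at `2` — `v₂(N_W) = 1`, while a CM
  theta newform with trivial character has `v₂(M) ∈ {0} ∪ [2, ∞)` — whereas the `max 2` form is what Condition 1 needs
  and what an `ℓ`-minimal partner delivers on the class: if `ρ̄` is ramified at `ℓ ≠ p` then `v_ℓ(N(ρ̄)) = v_ℓ(N_W)`
  (inertia image in `SL₂(𝔽_p) ∩ N(C_ns(p))`, no fixed line; wild inertia injects mod `p`), else `v_ℓ(N_W) ≤ 2`);
* **Kan₂@p(ε)**, **Kλ₂@p(ε)** = Kan@p(ε), Kλ@p(ε) with that clause as an extra PREMISE on the partner datum (weaker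
  statements: only level-matched partners need the layer congruence / residual count).

* §8 `lamTransport_of_rtt_levelMatched` — K0₂ ∧ Kan₂(ε) ∧ Kλ₂(ε) ⟹ part 1's λ-transport `hlamT` at `ε` (logic +
  part 2's `exists_depletionPlaces` / `exists_layer_ge_of_sign`); `exists_kobayashiMainConjecture_of_oneSignFloor_of_rtt_levelMatched`
  — any odd `p`, per pair: print ∧ one-sign floor (23117 shape) ∧ K0₂ ∧ Kan₂ ∧ Kλ₂ ⟹ `∃ ε, KobayashiMainConjecture W p ε`.
* §9 `stub_lambdaLowerThree_ns_of_rtt` — CLASS-WIDE at `p = 3`: print (`hJ h12 h41 h5 h3`) ∧ K0₂@3 ∧ Kan₂@3 ∧ Kλ₂@3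
  (universally quantified over crux L's `p = 3` domain) ⟹ the registered stub `stub_lambdaLowerThree_ns` VERBATIM (no
  `μ`-hypothesis: RTT's Kμ⁺ is PROVED at `3` on the class — THEOREM B + lane B — inside part 1).

The three statements are print-composite at odd `p` (reader sheet §1–§4; part 2's docstring) and NOT typed: the
verdict `stub-blocked` stands as a kernel matter. Nothing booked; crux L / BSD NOT proved. Memo: crux dir
`Lines/birth_acns-MEMO-w3-g8.md`.

References: [Kobayashi2003] Conjecture (p. 2), Thm. 1.2, Thm. 4.1 (p. 8), Thm. 7.4 (p. 13); [PollackWeston2011MT]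
§2.1–§2.2, §3.1, Thm. 4.1; [Vatsal1999] §1 (1.1)–(1.6), Thm. (1.13) (Condition 1); [GreenbergVatsal2000] §1 (8)–(10),
Prop. (2.8), Thm. (1.4), proof of Thm. (3.10); [HatleyLei2019] Thm. 4.6; [BDKim2009] Cor. 2.13; [PollackRubin2004]
Theorem (p. 448); [JohnsonLeungKings2011] Thm. 5.2; [Kato2004Asterisque] §15; [Lei2011] Cor. 6.9; [Carayol1986] (conductor of `ρ̄`).
-/

set_option autoImplicit false
-- D-0017: single-problem summit, the namespace repeats the problem name by design.
set_option linter.dupNamespace false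
noncomputable section

open scoped Classical MatrixGroups ModularForm BigOperators

open CongruenceSubgroup WeierstrassCurve Field Polynomial NumberField IsDedekindDomain
  Literature.NumberTheory.EllipticCurves Literature.NumberTheory.EllipticCurves.ModularForms
  Literature.NumberTheory.EllipticCurves.Rank1Residual
  Literature.NumberTheory.EllipticCurves.Kobayashi2003
  Literature.NumberTheory.EllipticCurves.GreenbergVatsal2000 ZpExtension
  Literature.NumberTheory.IwasawaTheory Rat.HeightOneSpectrum
  Summit.BirchSwinnertonDyer.Rank1Residual.Supersingular
  Summit.BirchSwinnertonDyer.Rank1Residual.X1.MuLambda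

namespace Summit.BirchSwinnertonDyer.BirchSwinnertonDyer.Theorems.SmallImageLambdaLowerThreeNsThetaTransport

/-! ## §8 The λ-TRANSPORT and `∃ ε, KobayashiMainConjecture` from the LEVEL-MATCHED statements (any odd `p`) -/

section LevelMatched

variable (W : WeierstrassCurve ℚ) [W.IsElliptic] [W.IsGloballyMinimal] (p : ℕ) [Fact p.Prime]

/-- **The λ-TRANSPORT at the sign `ε` from the LEVEL-MATCHED statements K0₂@p ∧ Kan₂@p(ε) ∧ Kλ₂@p(ε)** (= part 2's
`lamTransport_of_rtt` with the carry clause (C-S6/S7) «`max 2 (v_ℓ M) = max 2 (v_ℓ N_W)` for every prime `ℓ ≠ p`»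
threaded: a conjunct of the partner statement, a premise of the layer congruence and of the residual count).
Pure logic + `exists_depletionPlaces` + `exists_layer_ge_of_sign`. Nothing is asserted.
[cite: PollackWeston2011MT, §2.1 (2.1), §2.2 Def. 2.1, §3.1] [cite: Vatsal1999, §1 (1.2) Condition 1] [cite: GreenbergVatsal2000, §1 (8)–(10), proof of Thm. (3.10)] -/
theorem lamTransport_of_rtt_levelMatched (hgood : W.HasGoodReductionAtPrime p) (ε : ℤˣ)
    (hP : ∃ (M : ℕ) (_ : NeZero M) (g : CuspForm (Gamma0 M) 2) (ι : coeffField g →+* PadicAlgCl p) (Ω : ℂ),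
        ¬ p ∣ M ∧ (∀ ℓ : ℕ, ℓ.Prime → ℓ ≠ p → max 2 (padicValNat ℓ M) = max 2 (padicValNat ℓ (W.conductorNorm ℤ))) ∧
          IsNewform0 g ∧ Literature.NumberTheory.Automorphic.IsCMForm (liftToGamma1 M 2 g) ∧
          cuspCoeff g p = 0 ∧ IsCohomologicalPlusPeriod g ι Ω ∧
          (∀ ℓ : ℕ, ℓ.Prime → ¬ ℓ ∣ p * M * W.conductorNorm ℤ →
            ‖embCoeff g ι ℓ - (W.frobeniusTrace ℓ : PadicAlgCl p)‖ < 1))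
    (han : ∀ (M : ℕ) [NeZero M] (g : CuspForm (Gamma0 M) 2) (ι : coeffField g →+* PadicAlgCl p) (Ω : ℂ),
        ¬ p ∣ M → (∀ ℓ : ℕ, ℓ.Prime → ℓ ≠ p → max 2 (padicValNat ℓ M) = max 2 (padicValNat ℓ (W.conductorNorm ℤ))) →
        IsNewform0 g → Literature.NumberTheory.Automorphic.IsCMForm (liftToGamma1 M 2 g) →
        cuspCoeff g p = 0 → IsPlusPeriod g Ω →
        (∀ ℓ : ℕ, ℓ.Prime → ¬ ℓ ∣ p * M * W.conductorNorm ℤ →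
          ‖embCoeff g ι ℓ - (W.frobeniusTrace ℓ : PadicAlgCl p)‖ < 1) →
        ∀ [NeZero (W.conductorNorm ℤ)] (f : CuspForm (Gamma0 (W.conductorNorm ℤ)) 2), IsNewformOf W f →
        ∀ (Lplus Lminus : IwasawaAlgebra p), IsPollackPair f p Lplus Lminus →
          HasUnitContent (kobayashiL ε Lplus Lminus) →
        ∀ (S₀ : Finset (HeightOneSpectrum (𝓞 ℚ))), (∀ v ∈ S₀, ((p : ℕ) : 𝓞 ℚ) ∉ v.asIdeal) →
          (∀ v : HeightOneSpectrum (𝓞 ℚ), ¬ W.HasGoodReductionAt v → v ∈ S₀) →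
          (∀ v : HeightOneSpectrum (𝓞 ℚ), natGenerator v ∣ M → v ∈ S₀) →
        ∃ n₀ : ℕ, ∀ n ≥ n₀, (Even n ↔ ε = 1) →
          layerLambda (((mazurTateElement f p n).map (algebraMap ℚ (PadicAlgCl p)) *
              ∏ v ∈ S₀, ((W.localPolynomialAt v).map (Int.castRingHom (PadicAlgCl p))).comp
                (C ((natGenerator v : PadicAlgCl p)⁻¹) *
                  (X + 1) ^ (PadicInt.toZModPow n (-(frobeniusExponent p (natGenerator v : ℤ_[p])))).val)) %ₘ
              ((X + 1) ^ p ^ n - 1)) =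
          layerLambda (((mazurTateElementK g Ω p n).map ι *
              ∏ v ∈ S₀, (1 - C (embCoeff g ι (natGenerator v)) * X +
                  (if natGenerator v ∣ M then 0 else C (natGenerator v : PadicAlgCl p)) * X ^ 2).comp
                (C ((natGenerator v : PadicAlgCl p)⁻¹) *
                  (X + 1) ^ (PadicInt.toZModPow n (-(frobeniusExponent p (natGenerator v : ℤ_[p])))).val)) %ₘ
              ((X + 1) ^ p ^ n - 1)))
    (hlam : ∀ (M : ℕ) [NeZero M] (g : CuspForm (Gamma0 M) 2) (ι : coeffField g →+* PadicAlgCl p) (Ω : ℂ),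
        ¬ p ∣ M → (∀ ℓ : ℕ, ℓ.Prime → ℓ ≠ p → max 2 (padicValNat ℓ M) = max 2 (padicValNat ℓ (W.conductorNorm ℤ))) →
        IsNewform0 g → Literature.NumberTheory.Automorphic.IsCMForm (liftToGamma1 M 2 g) →
        cuspCoeff g p = 0 → IsPlusPeriod g Ω →
        (∀ ℓ : ℕ, ℓ.Prime → ¬ ℓ ∣ p * M * W.conductorNorm ℤ →
          ‖embCoeff g ι ℓ - (W.frobeniusTrace ℓ : PadicAlgCl p)‖ < 1) →
        ∀ (κ : ZpExtension ℚ p) (γ : absoluteGaloisGroup ℚ),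
          κ.IsCyclotomic → κ.IsTopGenerator γ → IsCyclotomicVariable p γ →
        ∀ [NeZero (W.conductorNorm ℤ)] (f : CuspForm (Gamma0 (W.conductorNorm ℤ)) 2), IsNewformOf W f →
        ∀ (ϖ : ℚ), (ϖ : ℝ) * W.realPeriodRat = plusPeriod f →
        ∀ (Lplus Lminus : IwasawaAlgebra p), IsPollackPair f p Lplus Lminus →
        ∀ (S₀ : Finset (HeightOneSpectrum (𝓞 ℚ))), (∀ v ∈ S₀, ((p : ℕ) : 𝓞 ℚ) ∉ v.asIdeal) →
          (∀ v : HeightOneSpectrum (𝓞 ℚ), ¬ W.HasGoodReductionAt v → v ∈ S₀) →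
          (∀ v : HeightOneSpectrum (𝓞 ℚ), natGenerator v ∣ M → v ∈ S₀) →
        ∀ (D : SignedSelmerDualData W κ γ ε) [Module.Finite (IwasawaAlgebra p) D.X],
          Module.IsTorsion (IwasawaAlgebra p) D.X → D.mu = 0 →
        ∀ (G : IwasawaAlgebra p) (m : ℕ),
          iwasawaToPowerSeries p G =
            PowerSeries.C ((p : ℚ_[p]) ^ m * (ϖ : ℚ_[p])) * iwasawaToPowerSeries p (kobayashiL ε Lplus Lminus) →
        ∃ n₀ : ℕ, ∀ n ≥ n₀, (Even n ↔ ε = 1) →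
          ((lambdaInvariant p D.X : ℕ) : ℤ) - ((lam G : ℕ) : ℤ) =
            ((layerLambda (((mazurTateElementK g Ω p n).map ι *
              ∏ v ∈ S₀, (1 - C (embCoeff g ι (natGenerator v)) * X +
                  (if natGenerator v ∣ M then 0 else C (natGenerator v : PadicAlgCl p)) * X ^ 2).comp
                (C ((natGenerator v : PadicAlgCl p)⁻¹) *
                  (X + 1) ^ (PadicInt.toZModPow n (-(frobeniusExponent p (natGenerator v : ℤ_[p])))).val)) %ₘ
              ((X + 1) ^ p ^ n - 1)) : ℕ) : ℤ) -
            ((layerLambda (((mazurTateElement f p n).map (algebraMap ℚ (PadicAlgCl p)) *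
              ∏ v ∈ S₀, ((W.localPolynomialAt v).map (Int.castRingHom (PadicAlgCl p))).comp
                (C ((natGenerator v : PadicAlgCl p)⁻¹) *
                  (X + 1) ^ (PadicInt.toZModPow n (-(frobeniusExponent p (natGenerator v : ℤ_[p])))).val)) %ₘ
              ((X + 1) ^ p ^ n - 1)) : ℕ) : ℤ))
    (κ : ZpExtension ℚ p) (γ : absoluteGaloisGroup ℚ) (hκ : κ.IsCyclotomic) (hγ : κ.IsTopGenerator γ)
    (hγ' : IsCyclotomicVariable p γ)
    [NeZero (W.conductorNorm ℤ)] (f : CuspForm (Gamma0 (W.conductorNorm ℤ)) 2) (hf : IsNewformOf W f)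
    (ϖ : ℚ) (hϖ : (ϖ : ℝ) * W.realPeriodRat = plusPeriod f)
    (Lplus Lminus : IwasawaAlgebra p) (hPP : IsPollackPair f p Lplus Lminus)
    (hfloor : HasUnitContent (kobayashiL ε Lplus Lminus))
    (D : SignedSelmerDualData W κ γ ε) [Module.Finite (IwasawaAlgebra p) D.X]
    (hX : Module.IsTorsion (IwasawaAlgebra p) D.X) (hμ : D.mu = 0)
    (G : IwasawaAlgebra p) (m : ℕ)
    (hG : iwasawaToPowerSeries p G =
      PowerSeries.C ((p : ℚ_[p]) ^ m * (ϖ : ℚ_[p])) * iwasawaToPowerSeries p (kobayashiL ε Lplus Lminus)) :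
    lambdaInvariant p D.X = lam G := by
  obtain ⟨M, _, g, ι, Ω, hpM, hlev, hnew, hcm, hapg, hΩ, hcong⟩ := hP
  obtain ⟨S₀, hS₀p, hS₀W, hS₀M⟩ := exists_depletionPlaces W p hgood M hpM
  obtain ⟨n₁, hn₁⟩ := han M g ι Ω hpM hlev hnew hcm hapg hΩ.isPlusPeriod hcong f hf Lplus Lminus hPP hfloor S₀
    hS₀p hS₀W hS₀M
  obtain ⟨n₂, hn₂⟩ := hlam M g ι Ω hpM hlev hnew hcm hapg hΩ.isPlusPeriod hcong κ γ hκ hγ hγ' f hf ϖ hϖ Lplus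
    Lminus hPP S₀ hS₀p hS₀W hS₀M D hX hμ G m hG
  obtain ⟨n, h1n, h2n, hpar⟩ := exists_layer_ge_of_sign ε n₁ n₂
  have h1 := hn₁ n h1n hpar
  have h2 := hn₂ n h2n hpar
  rw [h1, sub_self, sub_eq_zero] at h2
  exact_mod_cast h2

/-- **`∃ ε, KobayashiMainConjecture W p ε` at a small-image supersingular pair, ANY odd `p`, from print, the one-sign
analytic floor in 23117's shape and the LEVEL-MATCHED K0₂ ∧ Kan₂ ∧ Kλ₂** (= part 2's
`exists_kobayashiMainConjecture_of_oneSignFloor_of_rtt` with the carry clause threaded). The sign is fixed per curve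
(`LargeImageMuFloor.exists_sign_forall_isNewformOf`), the floor moved to the Pollack pair by `IsSignedPAdicLFunction.unique`,
then part 1 §2. ENGINE-FREE and PREPRINT-FREE; CONDITIONAL; closes nothing.
[cite: Kobayashi2003, Conjecture (p. 2), Thm. 1.2, Thm. 4.1 (p. 8)] [cite: PollackWeston2011MT, §3.1, Thm. 4.1 (1), Rem. 4.2] -/
theorem exists_kobayashiMainConjecture_of_oneSignFloor_of_rtt_levelMatched (hp : p ≠ 2)
    (hCK : thm62_63_73_signedColemanKato_zeta) (h12 : thm12_signedSelmerDual_finite_torsion)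
    (h41 : thm41_signedCharIdeal_divisibility)
    (h5 : realPeriodRat_eq_unit_mul_plusPeriod) (h3 : realPeriodRat_eq_unit_mul_plusPeriod_three)
    (hgood : W.HasGoodReductionAtPrime p) (hap : W.frobeniusTrace p = 0) (hs : ¬ Surj W p)
    (hfloor : ∀ [NeZero (W.conductorNorm ℤ)] (f : CuspForm (Gamma0 (W.conductorNorm ℤ)) 2), IsNewformOf W f →
      ∃ (ε₀ : ℤˣ) (L₀ : IwasawaAlgebra p), IsSignedPAdicLFunction f p ε₀ L₀ ∧ HasUnitContent L₀)
    (hP : ∃ (M : ℕ) (_ : NeZero M) (g : CuspForm (Gamma0 M) 2) (ι : coeffField g →+* PadicAlgCl p) (Ω : ℂ),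
        ¬ p ∣ M ∧ (∀ ℓ : ℕ, ℓ.Prime → ℓ ≠ p → max 2 (padicValNat ℓ M) = max 2 (padicValNat ℓ (W.conductorNorm ℤ))) ∧
          IsNewform0 g ∧ Literature.NumberTheory.Automorphic.IsCMForm (liftToGamma1 M 2 g) ∧
          cuspCoeff g p = 0 ∧ IsCohomologicalPlusPeriod g ι Ω ∧
          (∀ ℓ : ℕ, ℓ.Prime → ¬ ℓ ∣ p * M * W.conductorNorm ℤ →
            ‖embCoeff g ι ℓ - (W.frobeniusTrace ℓ : PadicAlgCl p)‖ < 1))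
    (han : ∀ (ε : ℤˣ), ∀ (M : ℕ) [NeZero M] (g : CuspForm (Gamma0 M) 2) (ι : coeffField g →+* PadicAlgCl p) (Ω : ℂ),
        ¬ p ∣ M → (∀ ℓ : ℕ, ℓ.Prime → ℓ ≠ p → max 2 (padicValNat ℓ M) = max 2 (padicValNat ℓ (W.conductorNorm ℤ))) →
        IsNewform0 g → Literature.NumberTheory.Automorphic.IsCMForm (liftToGamma1 M 2 g) →
        cuspCoeff g p = 0 → IsPlusPeriod g Ω →
        (∀ ℓ : ℕ, ℓ.Prime → ¬ ℓ ∣ p * M * W.conductorNorm ℤ →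
          ‖embCoeff g ι ℓ - (W.frobeniusTrace ℓ : PadicAlgCl p)‖ < 1) →
        ∀ [NeZero (W.conductorNorm ℤ)] (f : CuspForm (Gamma0 (W.conductorNorm ℤ)) 2), IsNewformOf W f →
        ∀ (Lplus Lminus : IwasawaAlgebra p), IsPollackPair f p Lplus Lminus →
          HasUnitContent (kobayashiL ε Lplus Lminus) →
        ∀ (S₀ : Finset (HeightOneSpectrum (𝓞 ℚ))), (∀ v ∈ S₀, ((p : ℕ) : 𝓞 ℚ) ∉ v.asIdeal) →
          (∀ v : HeightOneSpectrum (𝓞 ℚ), ¬ W.HasGoodReductionAt v → v ∈ S₀) →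
          (∀ v : HeightOneSpectrum (𝓞 ℚ), natGenerator v ∣ M → v ∈ S₀) →
        ∃ n₀ : ℕ, ∀ n ≥ n₀, (Even n ↔ ε = 1) →
          layerLambda (((mazurTateElement f p n).map (algebraMap ℚ (PadicAlgCl p)) *
              ∏ v ∈ S₀, ((W.localPolynomialAt v).map (Int.castRingHom (PadicAlgCl p))).comp
                (C ((natGenerator v : PadicAlgCl p)⁻¹) *
                  (X + 1) ^ (PadicInt.toZModPow n (-(frobeniusExponent p (natGenerator v : ℤ_[p])))).val)) %ₘ
              ((X + 1) ^ p ^ n - 1)) =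
          layerLambda (((mazurTateElementK g Ω p n).map ι *
              ∏ v ∈ S₀, (1 - C (embCoeff g ι (natGenerator v)) * X +
                  (if natGenerator v ∣ M then 0 else C (natGenerator v : PadicAlgCl p)) * X ^ 2).comp
                (C ((natGenerator v : PadicAlgCl p)⁻¹) *
                  (X + 1) ^ (PadicInt.toZModPow n (-(frobeniusExponent p (natGenerator v : ℤ_[p])))).val)) %ₘ
              ((X + 1) ^ p ^ n - 1)))
    (hlam : ∀ (ε : ℤˣ), ∀ (M : ℕ) [NeZero M] (g : CuspForm (Gamma0 M) 2) (ι : coeffField g →+* PadicAlgCl p) (Ω : ℂ),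
        ¬ p ∣ M → (∀ ℓ : ℕ, ℓ.Prime → ℓ ≠ p → max 2 (padicValNat ℓ M) = max 2 (padicValNat ℓ (W.conductorNorm ℤ))) →
        IsNewform0 g → Literature.NumberTheory.Automorphic.IsCMForm (liftToGamma1 M 2 g) →
        cuspCoeff g p = 0 → IsPlusPeriod g Ω →
        (∀ ℓ : ℕ, ℓ.Prime → ¬ ℓ ∣ p * M * W.conductorNorm ℤ →
          ‖embCoeff g ι ℓ - (W.frobeniusTrace ℓ : PadicAlgCl p)‖ < 1) →
        ∀ (κ : ZpExtension ℚ p) (γ : absoluteGaloisGroup ℚ),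
          κ.IsCyclotomic → κ.IsTopGenerator γ → IsCyclotomicVariable p γ →
        ∀ [NeZero (W.conductorNorm ℤ)] (f : CuspForm (Gamma0 (W.conductorNorm ℤ)) 2), IsNewformOf W f →
        ∀ (ϖ : ℚ), (ϖ : ℝ) * W.realPeriodRat = plusPeriod f →
        ∀ (Lplus Lminus : IwasawaAlgebra p), IsPollackPair f p Lplus Lminus →
        ∀ (S₀ : Finset (HeightOneSpectrum (𝓞 ℚ))), (∀ v ∈ S₀, ((p : ℕ) : 𝓞 ℚ) ∉ v.asIdeal) →
          (∀ v : HeightOneSpectrum (𝓞 ℚ), ¬ W.HasGoodReductionAt v → v ∈ S₀) →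
          (∀ v : HeightOneSpectrum (𝓞 ℚ), natGenerator v ∣ M → v ∈ S₀) →
        ∀ (D : SignedSelmerDualData W κ γ ε) [Module.Finite (IwasawaAlgebra p) D.X],
          Module.IsTorsion (IwasawaAlgebra p) D.X → D.mu = 0 →
        ∀ (G : IwasawaAlgebra p) (m : ℕ),
          iwasawaToPowerSeries p G =
            PowerSeries.C ((p : ℚ_[p]) ^ m * (ϖ : ℚ_[p])) * iwasawaToPowerSeries p (kobayashiL ε Lplus Lminus) →
        ∃ n₀ : ℕ, ∀ n ≥ n₀, (Even n ↔ ε = 1) →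
          ((lambdaInvariant p D.X : ℕ) : ℤ) - ((lam G : ℕ) : ℤ) =
            ((layerLambda (((mazurTateElementK g Ω p n).map ι *
              ∏ v ∈ S₀, (1 - C (embCoeff g ι (natGenerator v)) * X +
                  (if natGenerator v ∣ M then 0 else C (natGenerator v : PadicAlgCl p)) * X ^ 2).comp
                (C ((natGenerator v : PadicAlgCl p)⁻¹) *
                  (X + 1) ^ (PadicInt.toZModPow n (-(frobeniusExponent p (natGenerator v : ℤ_[p])))).val)) %ₘ
              ((X + 1) ^ p ^ n - 1)) : ℕ) : ℤ) -
            ((layerLambda (((mazurTateElement f p n).map (algebraMap ℚ (PadicAlgCl p)) *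
              ∏ v ∈ S₀, ((W.localPolynomialAt v).map (Int.castRingHom (PadicAlgCl p))).comp
                (C ((natGenerator v : PadicAlgCl p)⁻¹) *
                  (X + 1) ^ (PadicInt.toZModPow n (-(frobeniusExponent p (natGenerator v : ℤ_[p])))).val)) %ₘ
              ((X + 1) ^ p ^ n - 1)) : ℕ) : ℤ)) :
    ∃ ε : ℤˣ, KobayashiMainConjecture W p ε := by
  obtain ⟨ε₀, hε₀⟩ := LargeImageMuFloor.exists_sign_forall_isNewformOf (W := W)
    (fun ε f ↦ ∃ L₀ : IwasawaAlgebra p, IsSignedPAdicLFunction f p ε L₀ ∧ HasUnitContent L₀)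
    (fun f hf ↦ hfloor f hf)
  have hfl : ∀ [NeZero (W.conductorNorm ℤ)] (f : CuspForm (Gamma0 (W.conductorNorm ℤ)) 2), IsNewformOf W f →
      ∀ Lplus Lminus : IwasawaAlgebra p, IsPollackPair f p Lplus Lminus →
        HasUnitContent (kobayashiL ε₀ Lplus Lminus) := by
    intro _ f hf Lplus Lminus hPP
    obtain ⟨L₀, hL₀, hu⟩ := hε₀ f hf
    rwa [IsSignedPAdicLFunction.unique hL₀ (hPP.isSignedPAdicLFunction_kobayashiL ε₀)] at hu
  refine ⟨ε₀, kobayashiMainConjecture_of_lamTransport W p hp hCK h12 h41 h5 h3 hgood hap hs ε₀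
    (fun f hf Lplus Lminus hPP ↦ hfl f hf Lplus Lminus hPP) ?_⟩
  intro κ γ hκ hγ hγ' _ f hf ϖ hϖ Lplus Lminus hPP D _ hXt hμ G m hG
  exact lamTransport_of_rtt_levelMatched W p hgood ε₀ hP (han ε₀) (hlam ε₀) κ γ hκ hγ hγ' f hf ϖ hϖ Lplus Lminus
    hPP (hfl f hf Lplus Lminus hPP) D hXt hμ G m hG

end LevelMatched

/-! ## §9 CLASS-WIDE at `p = 3`: the registered stub `stub_lambdaLowerThree_ns` (= retired item 23118, VERBATIM) from
print ∧ K0₂@3 ∧ Kan₂@3 ∧ Kλ₂@3 on crux L's `p = 3` rows -/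

section ClassWide

/-- **CLASS-WIDE `p = 3`: print ∧ K0₂@3 ∧ Kan₂@3 ∧ Kλ₂@3 ⟹ `stub_lambdaLowerThree_ns` (VERBATIM text).** On every
small-image supersingular X7 pair at `p = 3` (`ClassX7 W 3`, non-CM, `a₃ = 0`, `ρ̄_{E,3}` not onto — the
`N(C_ns(3))` locus: `ρ̄ ≅ Ind_K χ̄`, `K` imaginary quadratic, `3` INERT in `K`; k3-c4 `…SmallImageShadowInert`):
GRANTED the published facts by name (`hJ` joint Coleman–Kato package, `h12`, `h41` rational clause, `h5`/`h3`) and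
the three LEVEL-MATCHED `p = 3` twins of route `ResidualThetaTransportAtTwo`'s items — `hK0` (K0⁺ 20690, PROVED at 2;
at 3: Hecke theta partner `g = θ_ψ`, `3 ∤ M`, `a₃(g) = 0`, level-matched off 3), `hKan` (Kan⁺ 20688; at 3: Vatsal
1999 = tree fact `vatsal1999_plusSymbol_congruence` + Pollack 2003, Condition 1 automatic under the level clause),
`hKlam` (Kλ⁺ 20787 = RLF 23110 ∧ RMC 24195; at 3: Greenberg–Vatsal (10) / B. D. Kim 2009 / Hatley–Lei 2019 Thm 4.6 and
the λ-part of the signed main conjecture for the CM form `g` at the inert prime) — the stub holds. No `μ`-hypothesis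
(Kμ⁺ at 3 = THEOREM B + lane B, inside part 1). CONDITIONAL on the three displayed statements (print-composite, ARM-P
sheet U-r02-AP: 0 GAP; NOT typed); closes nothing; crux L / BSD NOT proved.
[cite: Kobayashi2003, Conjecture (p. 2), Thm. 1.2, Thm. 4.1 (p. 8), Thm. 7.4 (p. 13)] [cite: PollackWeston2011MT, §2.1–§2.2, §3.1, Thm. 4.1]
[cite: Vatsal1999, §1 (1.6), Thm. (1.13)] [cite: GreenbergVatsal2000, §1 (8)–(10), Prop. (2.8), Thm. (1.4)]
[cite: HatleyLei2019, Thm. 4.6] [cite: BDKim2009, Cor. 2.13] [cite: PollackRubin2004, Theorem (p. 448)] -/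
theorem stub_lambdaLowerThree_ns_of_rtt
    (hJ : thm62_63_73_signedColemanKato_zetaJoint) (h12 : thm12_signedSelmerDual_finite_torsion)
    (h41 : thm41_signedCharIdeal_divisibility)
    (h5 : realPeriodRat_eq_unit_mul_plusPeriod) (h3 : realPeriodRat_eq_unit_mul_plusPeriod_three)
    (hK0 : ∀ (W : WeierstrassCurve ℚ) [W.IsElliptic] [W.IsGloballyMinimal] (p : ℕ) [Fact p.Prime],
      p = 3 → ClassX7 W p → ¬ W.HasCM → W.frobeniusTrace p = 0 → ¬ Surj W p →
      ∃ (M : ℕ) (_ : NeZero M) (g : CuspForm (Gamma0 M) 2) (ι : coeffField g →+* PadicAlgCl p) (Ω : ℂ),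
        ¬ p ∣ M ∧ (∀ ℓ : ℕ, ℓ.Prime → ℓ ≠ p → max 2 (padicValNat ℓ M) = max 2 (padicValNat ℓ (W.conductorNorm ℤ))) ∧
          IsNewform0 g ∧ Literature.NumberTheory.Automorphic.IsCMForm (liftToGamma1 M 2 g) ∧
          cuspCoeff g p = 0 ∧ IsCohomologicalPlusPeriod g ι Ω ∧
          (∀ ℓ : ℕ, ℓ.Prime → ¬ ℓ ∣ p * M * W.conductorNorm ℤ →
            ‖embCoeff g ι ℓ - (W.frobeniusTrace ℓ : PadicAlgCl p)‖ < 1))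
    (hKan : ∀ (W : WeierstrassCurve ℚ) [W.IsElliptic] [W.IsGloballyMinimal] (p : ℕ) [Fact p.Prime],
      p = 3 → ClassX7 W p → ¬ W.HasCM → W.frobeniusTrace p = 0 → ¬ Surj W p →
      ∀ (ε : ℤˣ), ∀ (M : ℕ) [NeZero M] (g : CuspForm (Gamma0 M) 2) (ι : coeffField g →+* PadicAlgCl p) (Ω : ℂ),
        ¬ p ∣ M → (∀ ℓ : ℕ, ℓ.Prime → ℓ ≠ p → max 2 (padicValNat ℓ M) = max 2 (padicValNat ℓ (W.conductorNorm ℤ))) →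
        IsNewform0 g → Literature.NumberTheory.Automorphic.IsCMForm (liftToGamma1 M 2 g) →
        cuspCoeff g p = 0 → IsPlusPeriod g Ω →
        (∀ ℓ : ℕ, ℓ.Prime → ¬ ℓ ∣ p * M * W.conductorNorm ℤ →
          ‖embCoeff g ι ℓ - (W.frobeniusTrace ℓ : PadicAlgCl p)‖ < 1) →
        ∀ [NeZero (W.conductorNorm ℤ)] (f : CuspForm (Gamma0 (W.conductorNorm ℤ)) 2), IsNewformOf W f →
        ∀ (Lplus Lminus : IwasawaAlgebra p), IsPollackPair f p Lplus Lminus →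
          HasUnitContent (kobayashiL ε Lplus Lminus) →
        ∀ (S₀ : Finset (HeightOneSpectrum (𝓞 ℚ))), (∀ v ∈ S₀, ((p : ℕ) : 𝓞 ℚ) ∉ v.asIdeal) →
          (∀ v : HeightOneSpectrum (𝓞 ℚ), ¬ W.HasGoodReductionAt v → v ∈ S₀) →
          (∀ v : HeightOneSpectrum (𝓞 ℚ), natGenerator v ∣ M → v ∈ S₀) →
        ∃ n₀ : ℕ, ∀ n ≥ n₀, (Even n ↔ ε = 1) →
          layerLambda (((mazurTateElement f p n).map (algebraMap ℚ (PadicAlgCl p)) *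
              ∏ v ∈ S₀, ((W.localPolynomialAt v).map (Int.castRingHom (PadicAlgCl p))).comp
                (C ((natGenerator v : PadicAlgCl p)⁻¹) *
                  (X + 1) ^ (PadicInt.toZModPow n (-(frobeniusExponent p (natGenerator v : ℤ_[p])))).val)) %ₘ
              ((X + 1) ^ p ^ n - 1)) =
          layerLambda (((mazurTateElementK g Ω p n).map ι *
              ∏ v ∈ S₀, (1 - C (embCoeff g ι (natGenerator v)) * X +
                  (if natGenerator v ∣ M then 0 else C (natGenerator v : PadicAlgCl p)) * X ^ 2).comp
                (C ((natGenerator v : PadicAlgCl p)⁻¹) *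
                  (X + 1) ^ (PadicInt.toZModPow n (-(frobeniusExponent p (natGenerator v : ℤ_[p])))).val)) %ₘ
              ((X + 1) ^ p ^ n - 1)))
    (hKlam : ∀ (W : WeierstrassCurve ℚ) [W.IsElliptic] [W.IsGloballyMinimal] (p : ℕ) [Fact p.Prime],
      p = 3 → ClassX7 W p → ¬ W.HasCM → W.frobeniusTrace p = 0 → ¬ Surj W p →
      ∀ (ε : ℤˣ), ∀ (M : ℕ) [NeZero M] (g : CuspForm (Gamma0 M) 2) (ι : coeffField g →+* PadicAlgCl p) (Ω : ℂ),
        ¬ p ∣ M → (∀ ℓ : ℕ, ℓ.Prime → ℓ ≠ p → max 2 (padicValNat ℓ M) = max 2 (padicValNat ℓ (W.conductorNorm ℤ))) →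
        IsNewform0 g → Literature.NumberTheory.Automorphic.IsCMForm (liftToGamma1 M 2 g) →
        cuspCoeff g p = 0 → IsPlusPeriod g Ω →
        (∀ ℓ : ℕ, ℓ.Prime → ¬ ℓ ∣ p * M * W.conductorNorm ℤ →
          ‖embCoeff g ι ℓ - (W.frobeniusTrace ℓ : PadicAlgCl p)‖ < 1) →
        ∀ (κ : ZpExtension ℚ p) (γ : absoluteGaloisGroup ℚ),
          κ.IsCyclotomic → κ.IsTopGenerator γ → IsCyclotomicVariable p γ →
        ∀ [NeZero (W.conductorNorm ℤ)] (f : CuspForm (Gamma0 (W.conductorNorm ℤ)) 2), IsNewformOf W f →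
        ∀ (ϖ : ℚ), (ϖ : ℝ) * W.realPeriodRat = plusPeriod f →
        ∀ (Lplus Lminus : IwasawaAlgebra p), IsPollackPair f p Lplus Lminus →
        ∀ (S₀ : Finset (HeightOneSpectrum (𝓞 ℚ))), (∀ v ∈ S₀, ((p : ℕ) : 𝓞 ℚ) ∉ v.asIdeal) →
          (∀ v : HeightOneSpectrum (𝓞 ℚ), ¬ W.HasGoodReductionAt v → v ∈ S₀) →
          (∀ v : HeightOneSpectrum (𝓞 ℚ), natGenerator v ∣ M → v ∈ S₀) →
        ∀ (D : SignedSelmerDualData W κ γ ε) [Module.Finite (IwasawaAlgebra p) D.X],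
          Module.IsTorsion (IwasawaAlgebra p) D.X → D.mu = 0 →
        ∀ (G : IwasawaAlgebra p) (m : ℕ),
          iwasawaToPowerSeries p G =
            PowerSeries.C ((p : ℚ_[p]) ^ m * (ϖ : ℚ_[p])) * iwasawaToPowerSeries p (kobayashiL ε Lplus Lminus) →
        ∃ n₀ : ℕ, ∀ n ≥ n₀, (Even n ↔ ε = 1) →
          ((lambdaInvariant p D.X : ℕ) : ℤ) - ((lam G : ℕ) : ℤ) =
            ((layerLambda (((mazurTateElementK g Ω p n).map ι *
              ∏ v ∈ S₀, (1 - C (embCoeff g ι (natGenerator v)) * X +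
                  (if natGenerator v ∣ M then 0 else C (natGenerator v : PadicAlgCl p)) * X ^ 2).comp
                (C ((natGenerator v : PadicAlgCl p)⁻¹) *
                  (X + 1) ^ (PadicInt.toZModPow n (-(frobeniusExponent p (natGenerator v : ℤ_[p])))).val)) %ₘ
              ((X + 1) ^ p ^ n - 1)) : ℕ) : ℤ) -
            ((layerLambda (((mazurTateElement f p n).map (algebraMap ℚ (PadicAlgCl p)) *
              ∏ v ∈ S₀, ((W.localPolynomialAt v).map (Int.castRingHom (PadicAlgCl p))).comp
                (C ((natGenerator v : PadicAlgCl p)⁻¹) *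
                  (X + 1) ^ (PadicInt.toZModPow n (-(frobeniusExponent p (natGenerator v : ℤ_[p])))).val)) %ₘ
              ((X + 1) ^ p ^ n - 1)) : ℕ) : ℤ)) :
    ∀ (W : WeierstrassCurve ℚ) [W.IsElliptic] [W.IsGloballyMinimal] (p : ℕ) [Fact p.Prime],
      p = 3 → ClassX7 W p → ¬ W.HasCM → W.frobeniusTrace p = 0 → ¬ Surj W p →
      ∀ (ε : ℤˣ) (κ : ZpExtension ℚ p) (γ : Field.absoluteGaloisGroup ℚ),
        κ.IsCyclotomic → κ.IsTopGenerator γ → IsCyclotomicVariable p γ →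
      ∀ [NeZero (W.conductorNorm ℤ)] (f : CuspForm (Gamma0 (W.conductorNorm ℤ)) 2),
        IsNewformOf W f → ∀ (ϖ : ℚ), (ϖ : ℝ) * W.realPeriodRat = plusPeriod f →
      ∀ (Lplus Lminus : IwasawaAlgebra p), IsPollackPair f p Lplus Lminus →
      ∀ (D : SignedSelmerDualData W κ γ ε),
        ∃ (g h : IwasawaAlgebra p) (m : ℕ), D.charIdeal = Ideal.span {g} ∧
          iwasawaToPowerSeries p (PowerSeries.C ((p : ℤ_[p]) ^ m) * g) =
            PowerSeries.C (ϖ : ℚ_[p]) * iwasawaToPowerSeries p (kobayashiL ε Lplus Lminus * h) := by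
  intro W _ _ p _ hp3 hX hCM hap hs
  exact lambdaShape_three_of_lamTransport W p hp3 hJ h12 h41 h5 h3 hX hap hs
    (fun ε κ γ hκ hγ hγ' _ f hf ϖ hϖ Lplus Lminus hPP hfloor D _ hXt hμ G m hG ↦
      lamTransport_of_rtt_levelMatched W p hX.1.1 ε (hK0 W p hp3 hX hCM hap hs) (hKan W p hp3 hX hCM hap hs ε)
        (hKlam W p hp3 hX hCM hap hs ε) κ γ hκ hγ hγ' f hf ϖ hϖ Lplus Lminus hPP hfloor D hXt hμ G m hG)

end ClassWide

end Summit.BirchSwinnertonDyer.BirchSwinnertonDyer.Theorems.SmallImageLambdaLowerThreeNsThetaTransport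

end
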